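import Summits.ResolutionOfSingularities.ResolutionOfSingularities.Theorems.FrobeniusLadderFInjectiveMacaulayficationFDSpecimen
import Summits.ResolutionOfSingularities.ResolutionOfSingularities.Theorems.FrobeniusLadderFInjectiveMacaulayficationGoodSupportDominated
import HarnessLib

/-!
# BED T SHIFTED `f_T′ = σ(f_T) = z² − x⁸ + y⁴ + u⁴ + t⁵` (char 3; `f_T = z² + x⁴z + y⁴ + u⁴ + t⁵`, `σ : z ↦ z + x⁴`): the INPUT FACTS of the class row — prime, no variable vanishes,
# regular off the vertex, ★ WEAKLY NON-DEGENERATE ALONG EVERY POSITIVE WEIGHT (Brieskorn–Pham support after the shift; BED T itself is not convenient in `x`, R21.39 (1))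
# (crux `FInjectiveMacaulayfication` stmt-ResolutionOfSingularities-15315, chain w45a; (W-WND) class-route COVERAGE PROGRAMME, res-L1-w45a-plan-1 RULING R22.14 (1); seat
# res-L1-w45a-stub-2 g11; template = this seatʼs ✓ p680603 `Sigma5P2d4CSpecimen` (itself on res-L1-w45a-stub-3 g11ʼs `FDSpecimen` §1))

[OURS · L1 W4.5a] Support file (`--supports stmt-ResolutionOfSingularities-15315 --as helper`); def-free, unconditional; replaces the role of NO printed item; NOT a statement
of the manuscript; AI-written (AI review is weaker than expert review).

`X 0 = x`, `X 1 = y`, `X 2 = u`, `X 3 = t`, `X 4 = z`; `f_T′ = X 4 ^ 2 - X 0 ^ 8 + X 1 ^ 4 + X 2 ^ 4 + X 3 ^ 5` — in characteristic 3, `(z + x⁴)² + x⁴(z + x⁴) = z² + 3x⁴z + 2x⁸ = z² − x⁸`,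
so `f_T′ = f_T(x,y,u,t,z+x⁴)` with `f_T = z² + x⁴z + y⁴ + u⁴ + t⁵` = BED T of ✓ p674181 `Lx3p3PointFloorRow.f4pos_p3_rowT`. ANY field `k` of characteristic 3 unless stated.
* §1 `casts_char3`, `pderiv_zero_f` (`∂_x f_T′ = x⁷`), `pderiv_quart_f` (`∂_y, ∂_u f_T′ = y³, u³`), `pderiv_three_f` (`∂_t f_T′ = −t⁴`), `pderiv_four_f` (`∂_z f_T′ = 2z`), `constantCoeff_f`,
  ★ `prime_f` (Eisenstein-type in `T = z`: `T² + C(0)·T + C(c)`, `c = −x⁸+y⁴+u⁴+t⁵`, at `(x,y,u,t) = (0,1,1,1)`: `c = 3 = 0`, `∂_t c = 5t⁴ = 5 ≠ 0`), `regular_off_vertex` (= `hreg`: Jacobian off `𝔪` with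
  `x⁷, y³, u³, −t⁴`; `z` alone cannot miss a prime containing `x,y,u,t`: `z² = f_T′ − …`), `isPrime_span_f`, `f_not_mem_span_X`, ★ `mk_X_ne_zero` (= `hXne`);
* §2 ★★ `weaklyNondegenerate` — by the «good support» criterion ✓ p656259 `CensusBedsWeaklyNondegenerate.weaklyNondegenerate_of_good_support` (`β₀ = 2e_z`; `x⁸, y⁴, u⁴, t⁵` good in
  private variables with `8, 4, 4, 5 ≢ 0 (mod 3)`).
[folklore mathematics, OURS as a certificate; cite: Hartshorne1977, I Thm. 5.1; BoubakriGreuelMarkwig2010, §3 (p. 10)]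
-/

-- single-problem summit: the doubled namespace component is forced
set_option linter.dupNamespace false

noncomputable section

open AlgebraicGeometry CategoryTheory Literature.AlgebraicGeometry.Resolution TopologicalSpace IsLocalRing MvPolynomial

namespace Summit.ResolutionOfSingularities.ResolutionOfSingularities.Theorems.FInjectiveMacaulayfication.Lx3p3ShiftSpecimen

open Summit.ResolutionOfSingularities.ResolutionOfSingularities.Theorems.FInjectiveMacaulayfication
open Literature.AlgebraicGeometry.Resolution.BoubakriGreuelMarkwig

/-! ## §1 Derivatives, primality, regularity off the vertex, no variable vanishes -/

/-- In characteristic `3`: `3 = 0`, `4 = 1`, `5 = -1`, `8 = -1` in `k[X]`. [folklore] -/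
theorem casts_char3 (k : Type) [Field k] [CharP k 3] :
    (3 : MvPolynomial (Fin 5) k) = 0 ∧ (4 : MvPolynomial (Fin 5) k) = 1 ∧ (5 : MvPolynomial (Fin 5) k) = -1 ∧ (8 : MvPolynomial (Fin 5) k) = -1 := by
  have h3 : (3 : MvPolynomial (Fin 5) k) = 0 := by
    have h := CharP.cast_eq_zero (MvPolynomial (Fin 5) k) 3
    simpa using h
  refine ⟨h3, ?_, ?_, ?_⟩
  · calc (4 : MvPolynomial (Fin 5) k) = 3 + 1 := by norm_num
      _ = 1 := by rw [h3]; ring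
  · calc (5 : MvPolynomial (Fin 5) k) = 2 * 3 - 1 := by norm_num
      _ = -1 := by rw [h3]; ring
  · calc (8 : MvPolynomial (Fin 5) k) = 3 * 3 - 1 := by norm_num
      _ = -1 := by rw [h3]; ring

/-- `∂f/∂x = −8x⁷ = x⁷` in characteristic 3. [folklore] -/
theorem pderiv_zero_f (k : Type) [Field k] [CharP k 3] (f : MvPolynomial (Fin 5) k)
    (hf : f = X 4 ^ 2 - X 0 ^ 8 + X 1 ^ 4 + X 2 ^ 4 + X 3 ^ 5) : pderiv 0 f = X 0 ^ 7 := by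
  obtain ⟨-, -, -, h8⟩ := casts_char3 k
  rw [hf]
  simp only [map_add, map_sub, pderiv_pow, pderiv_X_self, pderiv_X_of_ne (show (4 : Fin 5) ≠ 0 by decide),
    pderiv_X_of_ne (show (1 : Fin 5) ≠ 0 by decide), pderiv_X_of_ne (show (2 : Fin 5) ≠ 0 by decide),
    pderiv_X_of_ne (show (3 : Fin 5) ≠ 0 by decide), mul_zero, mul_one, add_zero, zero_sub]
  push_cast
  rw [h8]
  ring

/-- `∂f/∂y = 4y³ = y³`, `∂f/∂u = 4u³ = u³` in characteristic 3. [folklore] -/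
theorem pderiv_quart_f (k : Type) [Field k] [CharP k 3] (f : MvPolynomial (Fin 5) k)
    (hf : f = X 4 ^ 2 - X 0 ^ 8 + X 1 ^ 4 + X 2 ^ 4 + X 3 ^ 5) (j : Fin 5) (hj : j = 1 ∨ j = 2) :
    pderiv j f = X j ^ 3 := by
  obtain ⟨-, h4, -, -⟩ := casts_char3 k
  rw [hf]
  rcases hj with rfl | rfl
  all_goals
    simp only [map_add, map_sub, pderiv_pow, pderiv_X_self, pderiv_X_of_ne (show (4 : Fin 5) ≠ 1 by decide),
      pderiv_X_of_ne (show (0 : Fin 5) ≠ 1 by decide), pderiv_X_of_ne (show (2 : Fin 5) ≠ 1 by decide),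
      pderiv_X_of_ne (show (3 : Fin 5) ≠ 1 by decide), pderiv_X_of_ne (show (4 : Fin 5) ≠ 2 by decide),
      pderiv_X_of_ne (show (0 : Fin 5) ≠ 2 by decide), pderiv_X_of_ne (show (1 : Fin 5) ≠ 2 by decide),
      pderiv_X_of_ne (show (3 : Fin 5) ≠ 2 by decide), mul_zero, mul_one, zero_add, add_zero, sub_zero]
    push_cast
    rw [h4]
    ring

/-- `∂f/∂t = 5t⁴ = −t⁴` in characteristic 3. [folklore] -/
theorem pderiv_three_f (k : Type) [Field k] [CharP k 3] (f : MvPolynomial (Fin 5) k)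
    (hf : f = X 4 ^ 2 - X 0 ^ 8 + X 1 ^ 4 + X 2 ^ 4 + X 3 ^ 5) : pderiv 3 f = -(X 3 ^ 4) := by
  obtain ⟨-, -, h5, -⟩ := casts_char3 k
  rw [hf]
  simp only [map_add, map_sub, pderiv_pow, pderiv_X_self, pderiv_X_of_ne (show (4 : Fin 5) ≠ 3 by decide),
    pderiv_X_of_ne (show (0 : Fin 5) ≠ 3 by decide), pderiv_X_of_ne (show (1 : Fin 5) ≠ 3 by decide),
    pderiv_X_of_ne (show (2 : Fin 5) ≠ 3 by decide), mul_zero, mul_one, zero_add, add_zero, sub_zero]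
  push_cast
  rw [h5]
  ring

/-- `∂f/∂z = 2z`. [folklore] -/
theorem pderiv_four_f (k : Type) [Field k] (f : MvPolynomial (Fin 5) k)
    (hf : f = X 4 ^ 2 - X 0 ^ 8 + X 1 ^ 4 + X 2 ^ 4 + X 3 ^ 5) : pderiv 4 f = 2 * X 4 := by
  rw [hf]
  simp only [map_add, map_sub, pderiv_pow, pderiv_X_self, pderiv_X_of_ne (show (0 : Fin 5) ≠ 4 by decide),
    pderiv_X_of_ne (show (1 : Fin 5) ≠ 4 by decide), pderiv_X_of_ne (show (2 : Fin 5) ≠ 4 by decide),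
    pderiv_X_of_ne (show (3 : Fin 5) ≠ 4 by decide), mul_zero, add_zero, sub_zero, mul_one]
  push_cast
  ring

/-- `f_T′` has no constant term. [folklore] -/
theorem constantCoeff_f (k : Type) [Field k] (f : MvPolynomial (Fin 5) k)
    (hf : f = X 4 ^ 2 - X 0 ^ 8 + X 1 ^ 4 + X 2 ^ 4 + X 3 ^ 5) : constantCoeff f = 0 := by
  rw [hf]
  simp [constantCoeff_X]

/-- ★ **`f_T′` is PRIME** (any field of characteristic 3): as `T² + C(0)·T + C(c)` in `T = z` over `k[x,y,u,t]`, `c = −x⁸ + y⁴ + u⁴ + t⁵`, Eisenstein-type at `(x,y,u,t) = (0,1,1,1)`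
where `c = 3 = 0` and `∂_t c = 5t⁴ = 5 ≠ 0`. [folklore] -/
theorem prime_f (k : Type) [Field k] [CharP k 3] (f : MvPolynomial (Fin 5) k)
    (hf : f = X 4 ^ 2 - X 0 ^ 8 + X 1 ^ 4 + X 2 ^ 4 + X 3 ^ 5) : Prime f := by
  set e : MvPolynomial (Fin 5) k ≃+* Polynomial (MvPolynomial (Fin 4) k) :=
    ((renameEquiv k (_root_.finRotate 5)).trans (finSuccEquiv k 4)).toRingEquiv with he_def
  have hrot4 : (_root_.finRotate 5) (4 : Fin 5) = 0 := by decide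
  have hrot : ∀ j : Fin 4, (_root_.finRotate 5) (Fin.castSucc j) = j.succ := by decide
  have he4 : e (X 4) = Polynomial.X := by
    show finSuccEquiv k 4 (rename _ (X 4)) = _
    rw [rename_X, hrot4]; exact finSuccEquiv_X_zero
  have hej : ∀ j : Fin 4, e (X (Fin.castSucc j)) = Polynomial.C (X j) := fun j => by
    show finSuccEquiv k 4 (rename _ (X (Fin.castSucc j))) = _
    rw [rename_X, hrot j]; exact finSuccEquiv_X_succ (j := j)
  set b : MvPolynomial (Fin 4) k := 0 with hb
  set c : MvPolynomial (Fin 4) k := -(X 0 ^ 8) + X 1 ^ 4 + X 2 ^ 4 + X 3 ^ 5 with hc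
  have hef : e f = Polynomial.X ^ 2 + Polynomial.C b * Polynomial.X + Polynomial.C c := by
    rw [hf, map_add, map_add, map_add, map_sub, map_pow, map_pow, map_pow, map_pow, map_pow, he4,
      show (0 : Fin 5) = Fin.castSucc (0 : Fin 4) from rfl, show (1 : Fin 5) = Fin.castSucc (1 : Fin 4) from rfl,
      show (2 : Fin 5) = Fin.castSucc (2 : Fin 4) from rfl, show (3 : Fin 5) = Fin.castSucc (3 : Fin 4) from rfl, hej, hej, hej, hej, hb, hc]
    simp only [map_add, map_neg, map_pow, map_zero, zero_mul, add_zero]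
    ring
  set a : Fin 4 → k := ![0, 1, 1, 1] with ha
  have h3 : (3 : k) = 0 := by simpa using CharP.cast_eq_zero k 3
  have h5 : (5 : k) ≠ 0 := by
    intro h
    have h2 : (2 : k) = 0 := by
      calc (2 : k) = 5 - 3 := by norm_num
        _ = 0 := by rw [h, h3]; ring
    exact (CensusBedsWeaklyNondegenerate.natCast_ne_zero_of_not_dvd (k := k) 3 2 (by norm_num)) (by simpa using h2)
  have hba : MvPolynomial.eval a b = 0 := by rw [hb, map_zero]
  have hca : MvPolynomial.eval a c = 0 := by
    rw [hc]
    simp only [map_add, map_neg, map_pow, eval_X, ha, Matrix.cons_val_zero, Matrix.cons_val_one]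
    simp only [Matrix.cons_val, one_pow, zero_pow (by norm_num : (8 : ℕ) ≠ 0), neg_zero, zero_add]
    rw [show (1 : k) + 1 + 1 = 3 by norm_num, h3]
  have hder : MvPolynomial.eval a (pderiv 3 c) ≠ 0 := by
    have e1 : pderiv 3 c = 5 * X 3 ^ 4 := by
      rw [hc]
      simp only [map_add, map_neg, pderiv_pow, pderiv_X_self, pderiv_X_of_ne (show (0 : Fin 4) ≠ 3 by decide),
        pderiv_X_of_ne (show (1 : Fin 4) ≠ 3 by decide), pderiv_X_of_ne (show (2 : Fin 4) ≠ 3 by decide), mul_zero, neg_zero, zero_add, mul_one]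
      push_cast
      ring
    rw [e1, map_mul, map_pow, eval_X, ha]
    simp only [Matrix.cons_val]
    rw [map_ofNat]
    simpa using h5
  have hirr : Irreducible (e f) := by
    rw [hef]
    exact Literature.AlgebraicGeometry.Motives.SmoothHypersurface.irreducible_X_pow_add_C_mul_X_add_C (d := 2) le_rfl b c a hba hca 3 hder
  exact (MulEquiv.prime_iff e).mp hirr.prime

/-- ★ **`(k[X]/(f_T′))_P` is regular at every prime `P ⊉ (x̄, ȳ, ū, t̄, z̄)`** (= the class rows' `hreg`): some variable other than `z` misses `P` (`z² = f_T′ + x⁸ − y⁴ − u⁴ − t⁵`),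
and then the partial `x⁷` (`∂_x`), `y³`, `u³` or `−t⁴` misses `P` (Jacobian criterion). [cite: Hartshorne1977, I Thm. 5.1] -/
theorem regular_off_vertex (k : Type) [Field k] [CharP k 3] (f : MvPolynomial (Fin 5) k)
    (hf : f = X 4 ^ 2 - X 0 ^ 8 + X 1 ^ 4 + X 2 ^ 4 + X 3 ^ 5)
    (P : Ideal (MvPolynomial (Fin 5) k ⧸ Ideal.span {f})) [P.IsPrime]
    (hP : ¬ Ideal.span (Set.range fun j : Fin 5 => Ideal.Quotient.mk (Ideal.span {f}) (X j)) ≤ P) :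
    IsRegularLocalRing (Localization.AtPrime P) := by
  have hP' : (P.comap (Ideal.Quotient.mk (Ideal.span {f}))).IsPrime := Ideal.comap_isPrime _ _
  set P' := P.comap (Ideal.Quotient.mk (Ideal.span {f})) with hP'def
  have hex : ∃ j : Fin 5, j ≠ 4 ∧ (X j : MvPolynomial (Fin 5) k) ∉ P' := by
    by_contra hall
    push Not at hall
    apply hP
    rw [Ideal.span_le]
    rintro _ ⟨j, rfl⟩
    change X j ∈ P'
    by_cases hj : j = 4
    · subst hj
      have hfP : f ∈ P' := FermatCubicConeChar2.self_mem_comap f P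
      have hx : (X 0 : MvPolynomial (Fin 5) k) ∈ P' := hall 0 (by decide)
      have hy : (X 1 : MvPolynomial (Fin 5) k) ∈ P' := hall 1 (by decide)
      have hu : (X 2 : MvPolynomial (Fin 5) k) ∈ P' := hall 2 (by decide)
      have ht : (X 3 : MvPolynomial (Fin 5) k) ∈ P' := hall 3 (by decide)
      have hz2 : (X 4 : MvPolynomial (Fin 5) k) ^ 2 ∈ P' := by
        have e : (X 4 : MvPolynomial (Fin 5) k) ^ 2 = f + (X 0 ^ 8 - X 1 ^ 4 - X 2 ^ 4 - X 3 ^ 5) := by rw [hf]; ring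
        rw [e]
        refine Ideal.add_mem _ hfP (Ideal.sub_mem _ (Ideal.sub_mem _ (Ideal.sub_mem _ ?_ ?_) ?_) ?_)
        · exact Ideal.pow_mem_of_mem _ hx 8 (by norm_num)
        · exact Ideal.pow_mem_of_mem _ hy 4 (by norm_num)
        · exact Ideal.pow_mem_of_mem _ hu 4 (by norm_num)
        · exact Ideal.pow_mem_of_mem _ ht 5 (by norm_num)
      exact hP'.mem_of_pow_mem 2 hz2
    · exact hall j hj
  obtain ⟨j, hj4, hj⟩ := hex
  by_cases hj0 : j = 0
  · subst hj0
    exact HypersurfaceRegular.stub_hypersurfaceRegularOfPderiv k 5 f 0 P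
      (by rw [pderiv_zero_f k f hf]; exact fun h => hj (hP'.mem_of_pow_mem 7 h))
  · by_cases hj3 : j = 3
    · subst hj3
      exact HypersurfaceRegular.stub_hypersurfaceRegularOfPderiv k 5 f 3 P
        (by rw [pderiv_three_f k f hf]; exact fun h => hj (hP'.mem_of_pow_mem 4 ((Ideal.neg_mem_iff _).mp h)))
    · have hj12 : j = 1 ∨ j = 2 := by
        fin_cases j <;> simp_all
      exact HypersurfaceRegular.stub_hypersurfaceRegularOfPderiv k 5 f j P
        (by rw [pderiv_quart_f k f hf j hj12]; exact fun h => hj (hP'.mem_of_pow_mem 3 h))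

/-- `(f_T′)` is a prime ideal. [plumbing] -/
theorem isPrime_span_f (k : Type) [Field k] [CharP k 3] (f : MvPolynomial (Fin 5) k)
    (hf : f = X 4 ^ 2 - X 0 ^ 8 + X 1 ^ 4 + X 2 ^ 4 + X 3 ^ 5) : (Ideal.span {f}).IsPrime :=
  (Ideal.span_singleton_prime (prime_f k f hf).ne_zero).mpr (prime_f k f hf)

/-- `f_T′ ∉ (Xᵢ)` for every `i`: evaluate at a coordinate point with `Xᵢ = 0` where `f_T′ = 1` (`e_y`, resp. `e_u` for `i = y`). [folklore] -/
theorem f_not_mem_span_X (k : Type) [Field k] (f : MvPolynomial (Fin 5) k) (hf : f = X 4 ^ 2 - X 0 ^ 8 + X 1 ^ 4 + X 2 ^ 4 + X 3 ^ 5) :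
    ∀ i : Fin 5, f ∉ Ideal.span {(X i : MvPolynomial (Fin 5) k)} := by
  intro i h
  rw [Ideal.mem_span_singleton] at h
  obtain ⟨c, hc⟩ := h
  by_cases hi : i = 1
  · subst hi
    have := congrArg (MvPolynomial.eval (Pi.single 2 1 : Fin 5 → k)) hc
    rw [hf] at this
    simp at this
  · have := congrArg (MvPolynomial.eval (Pi.single 1 1 : Fin 5 → k)) hc
    rw [hf] at this
    have h1 : (Pi.single 1 1 : Fin 5 → k) i = 0 := by rw [Pi.single_apply, if_neg hi]
    simp [h1] at this

/-- ★ **No variable vanishes in `k[X]/(f_T′)`** (the class rows' binder `hXne`). [plumbing] -/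
theorem mk_X_ne_zero (k : Type) [Field k] [CharP k 3] (f : MvPolynomial (Fin 5) k) (hf : f = X 4 ^ 2 - X 0 ^ 8 + X 1 ^ 4 + X 2 ^ 4 + X 3 ^ 5)
    (i : Fin 5) : Ideal.Quotient.mk (Ideal.span {f}) (X i) ≠ 0 := fun h0 =>
  PrimeTransfer.X_not_mem_span_of_isPrime (isPrime_span_f k f hf) (f_not_mem_span_X k f hf i) (Ideal.Quotient.eq_zero_iff_mem.mp h0)

/-! ## §2 ★★ Weak non-degeneracy along every positive weight -/

/-- The support of `f_T′`: every exponent is one of `2e_z, 8e_x, 4e_y, 4e_u, 5e_t` (as `Finsupp.single`s). [folklore] -/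
theorem support_subset (k : Type) [Field k] (f : MvPolynomial (Fin 5) k) (hf : f = X 4 ^ 2 - X 0 ^ 8 + X 1 ^ 4 + X 2 ^ 4 + X 3 ^ 5) :
    ∀ α ∈ f.support, α = Finsupp.single 4 2 ∨ α = Finsupp.single 0 8 ∨ α = Finsupp.single 1 4 ∨ α = Finsupp.single 2 4 ∨ α = Finsupp.single 3 5 := by
  classical
  have hf' : f = monomial (Finsupp.single 4 2) 1 + monomial (Finsupp.single 0 8) (-1) + monomial (Finsupp.single 1 4) 1 +
      monomial (Finsupp.single 2 4) 1 + monomial (Finsupp.single 3 5) 1 := by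
    rw [hf, sub_eq_add_neg]; simp only [X_pow_eq_monomial]; rw [← map_neg]
  intro α hα
  rw [hf'] at hα
  rcases CensusBedsWeaklyNondegenerate.mem_support_add5 hα with h | h | h | h | h
  · exact Or.inl (CensusBedsWeaklyNondegenerate.eq_of_mem_support_monomial h)
  · exact Or.inr (Or.inl (CensusBedsWeaklyNondegenerate.eq_of_mem_support_monomial h))
  · exact Or.inr (Or.inr (Or.inl (CensusBedsWeaklyNondegenerate.eq_of_mem_support_monomial h)))
  · exact Or.inr (Or.inr (Or.inr (Or.inl (CensusBedsWeaklyNondegenerate.eq_of_mem_support_monomial h))))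
  · exact Or.inr (Or.inr (Or.inr (Or.inr (CensusBedsWeaklyNondegenerate.eq_of_mem_support_monomial h))))

/-- ★★ **`f_T′ = z² − x⁸ + y⁴ + u⁴ + t⁵` (char 3) IS WEAKLY NON-DEGENERATE ALONG EVERY POSITIVE WEIGHT** (good support: `β₀ = 2e_z`; `x⁸, y⁴, u⁴, t⁵` good in private variables,
`8, 4, 4, 5 ≢ 0 (mod 3)`). [OURS · elementary certificate; cite: BoubakriGreuelMarkwig2010, §3 (p. 10)] -/
theorem weaklyNondegenerate (k : Type) [Field k] [CharP k 3] (f : MvPolynomial (Fin 5) k)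
    (hf : f = X 4 ^ 2 - X 0 ^ 8 + X 1 ^ 4 + X 2 ^ 4 + X 3 ^ 5) :
    ∀ w : Fin 5 → ℝ, (∀ i, 0 < w i) → IsWeaklyNondegenerateAlong w (f : MvPowerSeries (Fin 5) k) := by
  classical
  have hsupp := support_subset k f hf
  have h8 : ((8 : ℕ) : k) ≠ 0 := CensusBedsWeaklyNondegenerate.natCast_ne_zero_of_not_dvd 3 8 (by norm_num)
  have h4 : ((4 : ℕ) : k) ≠ 0 := CensusBedsWeaklyNondegenerate.natCast_ne_zero_of_not_dvd 3 4 (by norm_num)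
  have h5 : ((5 : ℕ) : k) ≠ 0 := CensusBedsWeaklyNondegenerate.natCast_ne_zero_of_not_dvd 3 5 (by norm_num)
  refine CensusBedsWeaklyNondegenerate.weaklyNondegenerate_of_good_support f (prime_f k f hf).ne_zero (Finsupp.single 4 2) (fun α hα hne => ?_)
  rcases hsupp α hα with rfl | rfl | rfl | rfl | rfl
  · exact (hne rfl).elim
  · refine ⟨0, by simpa using h8, fun β hβ hβne => ?_⟩
    rcases hsupp β hβ with rfl | rfl | rfl | rfl | rfl
    · simp
    · exact (hβne rfl).elim
    · simp
    · simp
    · simp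
  · refine ⟨1, by simpa using h4, fun β hβ hβne => ?_⟩
    rcases hsupp β hβ with rfl | rfl | rfl | rfl | rfl
    · simp
    · simp
    · exact (hβne rfl).elim
    · simp
    · simp
  · refine ⟨2, by simpa using h4, fun β hβ hβne => ?_⟩
    rcases hsupp β hβ with rfl | rfl | rfl | rfl | rfl
    · simp
    · simp
    · simp
    · exact (hβne rfl).elim
    · simp
  · refine ⟨3, by simpa using h5, fun β hβ hβne => ?_⟩
    rcases hsupp β hβ with rfl | rfl | rfl | rfl | rfl
    · simp
    · simp
    · simp
    · simp
    · exact (hβne rfl).elim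

end Summit.ResolutionOfSingularities.ResolutionOfSingularities.Theorems.FInjectiveMacaulayfication.Lx3p3ShiftSpecimen

end
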